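/-
Origin: expansion seat `prover-pub-hodgecm-mc-discharge-3-0`, handover #2 14:12Z md5 f72d05db6f7c (255 l.; RE-FROZEN r2 (r1 0ad6edcc7f0d); NEW additive KERNEL leaf, ns HodgeCM.Model.HypCensus; imports row #1 `HodgeCM.Model.HypCensus.ArchDatumCoeff` + `HodgeCM.Vendored.H21.NumberTheory.Weil1964.ArchDualPairNoPositiveCharacter`; 0 defs, 5 theorems: `isArchWeilDatum_repTransport_archWeilRep` (over any `ι𝕎 : arch J_V × arch J_W →* Sp` with `hdict`, mod positive-character triviality on G_∞), `hasUnitaryLift_repTransport_archWeilRep_iff` ((w2′) at u ⇔ ‖c u‖ = 1), `isArchWeilDatum_repTransport_archWeilRep_of_archLocal`, `isArchWeilDatum_repTransport_archWeilRep_of_signs` = sub-item (c4) at the census site for `J_V = diag(tV)⊗1`, `J_W = diag(tW)⊗1` from SIGN FACTS per complex place (`hprofV/hprofW`), `hasUnitaryLift_repTransport_archWeilRep` (element-wise (w2′), needs only multiplicativity of `u ↦ γ (ϖ u)`). 0 Prop defs, 0 records, nothing cited, MODEL-N ±0, E unchanged. EVIDENCE: as row #1.) (`HOME/mc/pub-hodgecm-mc-discharge-3/stage/HodgeCM/Model/HypCensus/ArchDatumLift.lean`,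 md5 f72d05db, 255 lines);
landed by the gen-12 packager (p-g12) in gate run 36 as `HodgeCM/Model/HypCensus/ArchDatumLift.lean` (verbatim).
-/
/-
Origin: speedrun cell pub-hodgecm, MODEL-CONSTRUCTION sub-cell, discharge seat mc-discharge-3 (unit pub-hodgecm-mc-discharge-3,
seat prover-pub-hodgecm-mc-discharge-3-0), ticket D-3 = BINDER-OWNERS §1a rows 10/16/17 sub-item (c4) (w2′) unitary lifts of
binder-2's `archWeilRep` ((J-arch) §3(c) of BINDER-TRIAGE §50.2), 2026-08-19.
Target in PKG: `HodgeCM/Model/HypCensus/ArchDatumLift.lean` (NEW additive leaf; imports `ArchDatumCoeff` + the K-1 twin of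
the tree file `Weil1964/ArchDualPairNoPositiveCharacter` p188488).  KERNEL only: 0 records / named facts, 0 proof holes.
Checked against the hub tree by concatenation with `ArchFactor.lean` 55e596e2a0dc / `ArchDatum.lean` 13e0d54cb896 /
`ArchDatumCoeff.lean` (imports de-vendored), farm rc 0.
-/
import Summits.HodgeConjecture.HodgeCM.Model.HypCensus.ArchDatumCoeff
import Literature.NumberTheory.Weil1964.ArchDualPairNoPositiveCharacter

/-!
# Census kit (rows A12/A34), junction (J-arch) §3(c): (w2′) and the archimedean Weil datum of `archWeilRep`

Continuation of `ArchDatumCoeff.lean` ((w1) from coefficient continuity).  Here the unitary-lift clause (w2′) and the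
assembled `IsArchWeilDatum` for `repTransport e′ (archWeilRep …)` at the census site
`G_∞ = U(J_V)(E ⊗ ℝ) × U(J_W)(E ⊗ ℝ)`:

* `isArchWeilDatum_repTransport_archWeilRep` — over any `ι𝕎 : G_∞ →* Sp(ℝ^σ × ℝ^σ)` with `⇑(ι𝕎 u) = γ (ϖ u)`, the datum
  modulo «no non-trivial continuous positive multiplicative function on `G_∞`» (tree `isArchWeilDatum_of_coeff`);
  `hasUnitaryLift_repTransport_archWeilRep_iff` ((w2′) at `u` ⇔ `‖c u‖ = 1`); `hasUnitaryLift_repTransport_archWeilRep`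
  (element-wise (w2′) needing only multiplicativity of `u ↦ γ (ϖ u)`, no `ι𝕎`);
* that input DISCHARGED at the site: `isArchWeilDatum_repTransport_archWeilRep_of_archLocal` (from the local factors
  `U(σ_w J_V)(ℂ)`, `U(σ_w J_W)(ℂ)` along `UnitaryGroup.archPiEquiv` — tree `Weil1964/ArchDualPairNoPositiveCharacter` +
  `KonnoKonno2007/RealDualPairNoPositiveCharacter`) and **`isArchWeilDatum_repTransport_archWeilRep_of_signs`** — for the
  diagonal forms `J_V = diag(t_V) ⊗ 1`, `J_W = diag(t_W) ⊗ 1` of the pin, the full datum from SIGN FACTS only (at every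
  complex place, `σ_v(t_V)` and `σ_v(t_W)` each have at most one negative entry or are negative everywhere: `U(p,q)` with
  `min(p,q) ≤ 1`), the dictionary `hγ` and the continuity of `s_pair` on the archimedean pair group.

Nothing here is a claim of PerL/QW8. [Folland1989, §4.2, the Schur remark p. 156] is the provenance of the argument.
-/

set_option autoImplicit false

noncomputable section

open NumberField IsDedekindDomain MeasureTheory
open scoped Matrix
open scoped Kronecker Classical TensorProduct
open Literature.NumberTheory.Automorphic Literature.NumberTheory.Weil1964
open Literature.RepresentationTheory.HeisenbergGroup (polar Heisenberg symplecticGroup ofSymplectic)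
open Literature.NumberTheory.GelbartRogawski1991
open Literature.Analysis.SegalBargmann

namespace HodgeCM.Model.HypCensus

section Pair

variable (F E : Type) [Field F] [NumberField F] [Field E] [NumberField E] [Algebra F E]
variable (c : E ≃ₐ[F] E) (N M : ℕ) (JV : Matrix (Fin N) (Fin N) E) (JW : Matrix (Fin M) (Fin M) E)

/-! ## (w2′) and the datum — sub-item (c4) -/

/-- **The archimedean Weil datum of the pinned splitting** over `ι𝕎 : G_∞ →* Sp(ℝ^σ × ℝ^σ)` with `⇑(ι𝕎 u) = γ (ϖ u)`:
(w1) by `ArchDatumCoeff`, (w2) by `archWeilRep_rhoSD`, (w2′) from «no non-trivial continuous positive multiplicative function on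
`G_∞`» (tree `KonnoKonno2007/RealDualPairNoPositiveCharacter` for the KK groups `Π_v U(P_v,Q_v) × U(R_v,S_v)`).
[Folland1989, §4.2, the Schur remark p. 156] -/
theorem isArchWeilDatum_repTransport_archWeilRep [Algebra.IsQuadraticExtension F E] {δ : E} (hcδ : c δ = -δ)
    (hδ : δ ≠ 0) {d : F} (hd : δ * δ = algebraMap F E d) {TV : Matrix (Fin N) (Fin N) F} {TW : Matrix (Fin M) (Fin M) F}
    (hV : TV.IsSymm) (hW : TW.IsSymm) (hVd : IsUnit TV.det) (hWd : IsUnit TW.det)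
    (hJV : JV = TV.map (algebraMap F E)) (hJW : JW = TW.map (algebraMap F E))
    {n : ℕ} (e : Fin N × Fin M ≃ Fin n)
    (s : UnitaryGroup.adelicPair F E c N M JV JW →* adelicMpCont F (Fin n) (UnitaryDualPair.adelicGram F e TV TW))
    (hs : ∀ g, adelicMpCont.proj F (Fin n) (UnitaryDualPair.adelicGram F e TV TW) (s g) =
      UnitaryDualPair.toSp F E c N M e JV JW hcδ hδ hd hV hW hJV hJW g)
    (hsc : Continuous fun u => UnitaryDualPair.pairSplitting F E c N M e JV JW s (archProdHom F E c N M JV JW u))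
    {σ : Type} [Fintype σ] [DecidableEq σ] (e' : (Fin n → mixedEmbedding.mixedSpace F) ≃L[ℝ] (σ → ℝ))
    (hTa : IsUnit (archMat F (Fin n) (UnitaryDualPair.adelicGram F e TV TW)))
    {G' : Type*} [Monoid G'] [TopologicalSpace G'] {K : Type*} [TopologicalSpace K] {P : Type*} [TopologicalSpace P]
    {γ : G' → PhaseMap σ} {κ : K → G'} {a : P → G'} {WK : K → (SchwartzMap (σ → ℝ) ℂ →L[ℂ] SchwartzMap (σ → ℝ) ℂ)}
    {WA : P → (SchwartzMap (σ → ℝ) ℂ →L[ℂ] SchwartzMap (σ → ℝ) ℂ)} (D : KAKImplementerData γ κ a WK WA)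
    (ϖ : UnitaryGroup.arch F E c N JV × UnitaryGroup.arch F E c M JW → G') (hϖ : Continuous ϖ)
    (hγ : ∀ (u : UnitaryGroup.arch F E c N JV × UnitaryGroup.arch F E c M JW) (pq : (σ → ℝ) × (σ → ℝ)),
      archPhaseMap (UnitaryDualPair.adelicGram F e TV TW) e' hTa
        (UnitaryDualPair.toSp F E c N M e JV JW hcδ hδ hd hV hW hJV hJW
          (UnitaryGroup.adelicInl F E c N M JV JW (UnitaryGroup.archToAdelic F E c N JV u.1) *
            UnitaryGroup.adelicInr F E c N M JV JW (UnitaryGroup.archToAdelic F E c M JW u.2))) pq = γ (ϖ u) pq)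
    (ι𝕎 : UnitaryGroup.arch F E c N JV × UnitaryGroup.arch F E c M JW →* symplecticGroup (polar (dotPairing σ)))
    (hdict : ∀ (u : UnitaryGroup.arch F E c N JV × UnitaryGroup.arch F E c M JW) (pq : (σ → ℝ) × (σ → ℝ)),
      γ (ϖ u) pq = ((ι𝕎 u).1 : ((σ → ℝ) × (σ → ℝ)) ≃ₗ[ℝ] (σ → ℝ) × (σ → ℝ)) pq)
    (htriv : ∀ nn : UnitaryGroup.arch F E c N JV × UnitaryGroup.arch F E c M JW → ℝ,
      (∀ g h, nn (g * h) = nn g * nn h) → (∀ g, 0 < nn g) → Continuous nn → ∀ g, nn g = 1) :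
    IsArchWeilDatum ι𝕎 (repTransport e' (archWeilRep F E c N M JV JW hcδ hδ hd hV hW hVd hWd hJV hJW e s hs)) := by
  refine isArchWeilDatum_of_coeff D
    (continuous_repTransport_archWeilRep F E c N M JV JW hcδ hδ hd hV hW hVd hWd hJV hJW e s hs e') ϖ hϖ hdict ?_
    (continuous_repTransport_archWeilRep_apply_apply F E c N M JV JW hcδ hδ hd hV hW hVd hWd hJV hJW e s hs hsc e') htriv
  intro u p q f
  have h1 := isPhaseCovariantS_repTransport_archWeilRep F E c N M JV JW hcδ hδ hd hV hW hVd hWd hJV hJW e s hs e' hTa γ ϖ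
    hγ u p q f
  dsimp only at h1 ⊢
  rw [hdict] at h1
  exact h1

/-- **(w2′) at one element, criterion**: for the coefficient function `cf` of the transported representation against the
vacuum-normalised section (`exists_coeff`), `repTransport e′ (archWeilRep …) u` has a unitary lift iff `‖cf u‖ = 1`.
[Folland1989, §4.2, the Schur remark p. 156] -/
theorem hasUnitaryLift_repTransport_archWeilRep_iff [Algebra.IsQuadraticExtension F E] {δ : E} (hcδ : c δ = -δ)
    (hδ : δ ≠ 0) {d : F} (hd : δ * δ = algebraMap F E d) {TV : Matrix (Fin N) (Fin N) F} {TW : Matrix (Fin M) (Fin M) F}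
    (hV : TV.IsSymm) (hW : TW.IsSymm) (hVd : IsUnit TV.det) (hWd : IsUnit TW.det)
    (hJV : JV = TV.map (algebraMap F E)) (hJW : JW = TW.map (algebraMap F E))
    {n : ℕ} (e : Fin N × Fin M ≃ Fin n)
    (s : UnitaryGroup.adelicPair F E c N M JV JW →* adelicMpCont F (Fin n) (UnitaryDualPair.adelicGram F e TV TW))
    (hs : ∀ g, adelicMpCont.proj F (Fin n) (UnitaryDualPair.adelicGram F e TV TW) (s g) =
      UnitaryDualPair.toSp F E c N M e JV JW hcδ hδ hd hV hW hJV hJW g)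
    {σ : Type} [Fintype σ] [DecidableEq σ] (e' : (Fin n → mixedEmbedding.mixedSpace F) ≃L[ℝ] (σ → ℝ))
    (hTa : IsUnit (archMat F (Fin n) (UnitaryDualPair.adelicGram F e TV TW)))
    {G' : Type*} [Monoid G'] [TopologicalSpace G'] {K : Type*} [TopologicalSpace K] {P : Type*} [TopologicalSpace P]
    {γ : G' → PhaseMap σ} {κ : K → G'} {a : P → G'} {WK : K → (SchwartzMap (σ → ℝ) ℂ →L[ℂ] SchwartzMap (σ → ℝ) ℂ)}
    {WA : P → (SchwartzMap (σ → ℝ) ℂ →L[ℂ] SchwartzMap (σ → ℝ) ℂ)} (D : KAKImplementerData γ κ a WK WA)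
    (ϖ : UnitaryGroup.arch F E c N JV × UnitaryGroup.arch F E c M JW → G')
    (hγ : ∀ (u : UnitaryGroup.arch F E c N JV × UnitaryGroup.arch F E c M JW) (pq : (σ → ℝ) × (σ → ℝ)),
      archPhaseMap (UnitaryDualPair.adelicGram F e TV TW) e' hTa
        (UnitaryDualPair.toSp F E c N M e JV JW hcδ hδ hd hV hW hJV hJW
          (UnitaryGroup.adelicInl F E c N M JV JW (UnitaryGroup.archToAdelic F E c N JV u.1) *
            UnitaryGroup.adelicInr F E c N M JV JW (UnitaryGroup.archToAdelic F E c M JW u.2))) pq = γ (ϖ u) pq)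
    {cf : UnitaryGroup.arch F E c N JV × UnitaryGroup.arch F E c M JW → ℂ}
    (hcf : ∀ (u : UnitaryGroup.arch F E c N JV × UnitaryGroup.arch F E c M JW) (f : SchwartzMap (σ → ℝ) ℂ),
      repTransport e' (archWeilRep F E c N M JV JW hcδ hδ hd hV hW hVd hWd hJV hJW e s hs) u f = cf u • vacSection γ (ϖ u) f)
    (u : UnitaryGroup.arch F E c N JV × UnitaryGroup.arch F E c M JW) :
    (∃ U : Lp ℂ 2 (volume : Measure (σ → ℝ)) ≃ₗᵢ[ℂ] Lp ℂ 2 (volume : Measure (σ → ℝ)),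
      LiftsTo (repTransport e' (archWeilRep F E c N M JV JW hcδ hδ hd hV hW hVd hWd hJV hJW e s hs) u)
        ((U.toContinuousLinearEquiv : Lp ℂ 2 (volume : Measure (σ → ℝ)) ≃L[ℂ] Lp ℂ 2 (volume : Measure (σ → ℝ))) :
          Lp ℂ 2 (volume : Measure (σ → ℝ)) →L[ℂ] Lp ℂ 2 (volume : Measure (σ → ℝ)))) ↔ ‖cf u‖ = 1 :=
  ⟨fun h => norm_coeff_of_hasUnitaryLift D _
      (continuous_repTransport_archWeilRep F E c N M JV JW hcδ hδ hd hV hW hVd hWd hJV hJW e s hs e') ϖ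
      (isPhaseCovariantS_repTransport_archWeilRep F E c N M JV JW hcδ hδ hd hV hW hVd hWd hJV hJW e s hs e' hTa γ ϖ hγ)
      hcf h,
    fun h => hasUnitaryLift_of_norm_coeff D _ ϖ hcf h⟩

/-- **The datum from the local factors**: the positive-character input supplied place by place on
`U(σ_w J_V)(ℂ)` and `U(σ_w J_W)(ℂ)` (`archLocal`), transported along `UnitaryGroup.archPiEquiv`
(tree `Weil1964/ArchDualPairNoPositiveCharacter`; `c ≠ 1` fixing every infinite place of `E`, e.g. complex conjugation
of a CM field: `IsCMField.complexConj_ne_one`, `complexConj_smul_infinitePlace`). [Folland1989, §4.2, the Schur remark p. 156] -/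
theorem isArchWeilDatum_repTransport_archWeilRep_of_archLocal [Algebra.IsQuadraticExtension F E] {δ : E}
    (hcδ : c δ = -δ) (hδ : δ ≠ 0) {d : F} (hd : δ * δ = algebraMap F E d) {TV : Matrix (Fin N) (Fin N) F}
    {TW : Matrix (Fin M) (Fin M) F} (hV : TV.IsSymm) (hW : TW.IsSymm) (hVd : IsUnit TV.det) (hWd : IsUnit TW.det)
    (hJV : JV = TV.map (algebraMap F E)) (hJW : JW = TW.map (algebraMap F E))
    {n : ℕ} (e : Fin N × Fin M ≃ Fin n)
    (s : UnitaryGroup.adelicPair F E c N M JV JW →* adelicMpCont F (Fin n) (UnitaryDualPair.adelicGram F e TV TW))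
    (hs : ∀ g, adelicMpCont.proj F (Fin n) (UnitaryDualPair.adelicGram F e TV TW) (s g) =
      UnitaryDualPair.toSp F E c N M e JV JW hcδ hδ hd hV hW hJV hJW g)
    (hsc : Continuous fun u => UnitaryDualPair.pairSplitting F E c N M e JV JW s (archProdHom F E c N M JV JW u))
    {σ : Type} [Fintype σ] [DecidableEq σ] (e' : (Fin n → mixedEmbedding.mixedSpace F) ≃L[ℝ] (σ → ℝ))
    (hTa : IsUnit (archMat F (Fin n) (UnitaryDualPair.adelicGram F e TV TW)))
    {G' : Type*} [Monoid G'] [TopologicalSpace G'] {K : Type*} [TopologicalSpace K] {P : Type*} [TopologicalSpace P]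
    {γ : G' → PhaseMap σ} {κ : K → G'} {a : P → G'} {WK : K → (SchwartzMap (σ → ℝ) ℂ →L[ℂ] SchwartzMap (σ → ℝ) ℂ)}
    {WA : P → (SchwartzMap (σ → ℝ) ℂ →L[ℂ] SchwartzMap (σ → ℝ) ℂ)} (D : KAKImplementerData γ κ a WK WA)
    (ϖ : UnitaryGroup.arch F E c N JV × UnitaryGroup.arch F E c M JW → G') (hϖ : Continuous ϖ)
    (hγ : ∀ (u : UnitaryGroup.arch F E c N JV × UnitaryGroup.arch F E c M JW) (pq : (σ → ℝ) × (σ → ℝ)),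
      archPhaseMap (UnitaryDualPair.adelicGram F e TV TW) e' hTa
        (UnitaryDualPair.toSp F E c N M e JV JW hcδ hδ hd hV hW hJV hJW
          (UnitaryGroup.adelicInl F E c N M JV JW (UnitaryGroup.archToAdelic F E c N JV u.1) *
            UnitaryGroup.adelicInr F E c N M JV JW (UnitaryGroup.archToAdelic F E c M JW u.2))) pq = γ (ϖ u) pq)
    (ι𝕎 : UnitaryGroup.arch F E c N JV × UnitaryGroup.arch F E c M JW →* symplecticGroup (polar (dotPairing σ)))
    (hdict : ∀ (u : UnitaryGroup.arch F E c N JV × UnitaryGroup.arch F E c M JW) (pq : (σ → ℝ) × (σ → ℝ)),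
      γ (ϖ u) pq = ((ι𝕎 u).1 : ((σ → ℝ) × (σ → ℝ)) ≃ₗ[ℝ] (σ → ℝ) × (σ → ℝ)) pq)
    (hc1 : c ≠ 1) (hfix : ∀ w : InfinitePlace E, c • w = w)
    (hlocV : ∀ (w : {w : InfinitePlace E // w.IsComplex}) (nn : UnitaryGroup.archLocal E N JV w → ℝ),
      (∀ g h, nn (g * h) = nn g * nn h) → (∀ g, 0 < nn g) → Continuous nn → ∀ g, nn g = 1)
    (hlocW : ∀ (w : {w : InfinitePlace E // w.IsComplex}) (nn : UnitaryGroup.archLocal E M JW w → ℝ),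
      (∀ g h, nn (g * h) = nn g * nn h) → (∀ g, 0 < nn g) → Continuous nn → ∀ g, nn g = 1) :
    IsArchWeilDatum ι𝕎 (repTransport e' (archWeilRep F E c N M JV JW hcδ hδ hd hV hW hVd hWd hJV hJW e s hs)) :=
  isArchWeilDatum_repTransport_archWeilRep F E c N M JV JW hcδ hδ hd hV hW hVd hWd hJV hJW e s hs hsc e' hTa D ϖ hϖ hγ ι𝕎
    hdict (UnitaryGroup.mulPos_eq_one_archPair F E c N JV JW (UnitaryGroup.mulPos_eq_one_arch F E c N JV hc1 hfix hlocV)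
      (UnitaryGroup.mulPos_eq_one_arch F E c M JW hc1 hfix hlocW))

/-- **The datum from SIGN FACTS, diagonal forms** `J_V = diag(t_V) ⊗ 1`, `J_W = diag(t_W) ⊗ 1` (the GR91 / theta pin): at
every complex place `w` of `E` (fixed by `c ≠ 1`), `σ_v(t_V)` has at most one negative entry or is negative everywhere, and
likewise `σ_v(t_W)` — the rank profiles `U(p,q)`, `min(p,q) ≤ 1`, e.g. `U(2,1)`, `U(3)`, `U(1,1)`, `U(2)`, `U(0,2)`
(`UnitaryGroup.mulPos_eq_one_arch_diagonal`).  Together with the dictionary `hγ` (weil-2's `archPhaseMap_toSp_pair`) this is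
the whole (J-arch) datum `IsArchWeilDatum ι𝕎 (repTransport e′ archWeilRep)` at the census site `arch J_V × arch J_W`.
[Folland1989, §4.2, the Schur remark p. 156] -/
theorem isArchWeilDatum_repTransport_archWeilRep_of_signs [Algebra.IsQuadraticExtension F E] {δ : E}
    (hcδ : c δ = -δ) (hδ : δ ≠ 0) {d : F} (hd : δ * δ = algebraMap F E d) {tV : Fin N → F} {tW : Fin M → F}
    (hVd : IsUnit (Matrix.diagonal tV).det) (hWd : IsUnit (Matrix.diagonal tW).det)
    (hJV : JV = (Matrix.diagonal tV).map (algebraMap F E)) (hJW : JW = (Matrix.diagonal tW).map (algebraMap F E))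
    {n : ℕ} (e : Fin N × Fin M ≃ Fin n)
    (s : UnitaryGroup.adelicPair F E c N M JV JW →*
      adelicMpCont F (Fin n) (UnitaryDualPair.adelicGram F e (Matrix.diagonal tV) (Matrix.diagonal tW)))
    (hs : ∀ g, adelicMpCont.proj F (Fin n) (UnitaryDualPair.adelicGram F e (Matrix.diagonal tV) (Matrix.diagonal tW)) (s g) =
      UnitaryDualPair.toSp F E c N M e JV JW hcδ hδ hd (Matrix.isSymm_diagonal tV) (Matrix.isSymm_diagonal tW) hJV hJW g)
    (hsc : Continuous fun u => UnitaryDualPair.pairSplitting F E c N M e JV JW s (archProdHom F E c N M JV JW u))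
    {σ : Type} [Fintype σ] [DecidableEq σ] (e' : (Fin n → mixedEmbedding.mixedSpace F) ≃L[ℝ] (σ → ℝ))
    (hTa : IsUnit (archMat F (Fin n) (UnitaryDualPair.adelicGram F e (Matrix.diagonal tV) (Matrix.diagonal tW))))
    {G' : Type*} [Monoid G'] [TopologicalSpace G'] {K : Type*} [TopologicalSpace K] {P : Type*} [TopologicalSpace P]
    {γ : G' → PhaseMap σ} {κ : K → G'} {a : P → G'} {WK : K → (SchwartzMap (σ → ℝ) ℂ →L[ℂ] SchwartzMap (σ → ℝ) ℂ)}
    {WA : P → (SchwartzMap (σ → ℝ) ℂ →L[ℂ] SchwartzMap (σ → ℝ) ℂ)} (D : KAKImplementerData γ κ a WK WA)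
    (ϖ : UnitaryGroup.arch F E c N JV × UnitaryGroup.arch F E c M JW → G') (hϖ : Continuous ϖ)
    (hγ : ∀ (u : UnitaryGroup.arch F E c N JV × UnitaryGroup.arch F E c M JW) (pq : (σ → ℝ) × (σ → ℝ)),
      archPhaseMap (UnitaryDualPair.adelicGram F e (Matrix.diagonal tV) (Matrix.diagonal tW)) e' hTa
        (UnitaryDualPair.toSp F E c N M e JV JW hcδ hδ hd (Matrix.isSymm_diagonal tV) (Matrix.isSymm_diagonal tW) hJV hJW
          (UnitaryGroup.adelicInl F E c N M JV JW (UnitaryGroup.archToAdelic F E c N JV u.1) *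
            UnitaryGroup.adelicInr F E c N M JV JW (UnitaryGroup.archToAdelic F E c M JW u.2))) pq = γ (ϖ u) pq)
    (ι𝕎 : UnitaryGroup.arch F E c N JV × UnitaryGroup.arch F E c M JW →* symplecticGroup (polar (dotPairing σ)))
    (hdict : ∀ (u : UnitaryGroup.arch F E c N JV × UnitaryGroup.arch F E c M JW) (pq : (σ → ℝ) × (σ → ℝ)),
      γ (ϖ u) pq = ((ι𝕎 u).1 : ((σ → ℝ) × (σ → ℝ)) ≃ₗ[ℝ] (σ → ℝ) × (σ → ℝ)) pq)
    (hc1 : c ≠ 1) (hfix : ∀ w : InfinitePlace E, c • w = w)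
    (hprofV : ∀ w : {w : InfinitePlace E // w.IsComplex},
      (∃ i₀, ∀ i, i ≠ i₀ → 0 < UnitaryGroup.realPlaceMap F E c w (hfix w.1) hc1 (tV i)) ∨
        ∀ i, UnitaryGroup.realPlaceMap F E c w (hfix w.1) hc1 (tV i) < 0)
    (hprofW : ∀ w : {w : InfinitePlace E // w.IsComplex},
      (∃ j₀, ∀ j, j ≠ j₀ → 0 < UnitaryGroup.realPlaceMap F E c w (hfix w.1) hc1 (tW j)) ∨
        ∀ j, UnitaryGroup.realPlaceMap F E c w (hfix w.1) hc1 (tW j) < 0) :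
    IsArchWeilDatum ι𝕎 (repTransport e' (archWeilRep F E c N M JV JW hcδ hδ hd (Matrix.isSymm_diagonal tV)
      (Matrix.isSymm_diagonal tW) hVd hWd hJV hJW e s hs)) :=
  isArchWeilDatum_repTransport_archWeilRep F E c N M JV JW hcδ hδ hd (Matrix.isSymm_diagonal tV)
    (Matrix.isSymm_diagonal tW) hVd hWd hJV hJW e s hs hsc e' hTa D ϖ hϖ hγ ι𝕎 hdict
    (UnitaryGroup.mulPos_eq_one_archPair F E c N JV JW
      (UnitaryGroup.mulPos_eq_one_arch_diagonal F E c N JV hc1 hfix tV hJV (ne_zero_of_isUnit_det_diagonal hVd) hprofV)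
      (UnitaryGroup.mulPos_eq_one_arch_diagonal F E c M JW hc1 hfix tW hJW (ne_zero_of_isUnit_det_diagonal hWd) hprofW))

/-- **(w2′) element-wise without the phase homomorphism**: if the dictionary phase maps `u ↦ γ (ϖ u)` are multiplicative
(e.g. `ϖ` a homomorphism into the `KAK` monoid) and `G_∞` carries no non-trivial continuous positive multiplicative function,
every `repTransport e′ (archWeilRep …) u` has a unitary lift. [Folland1989, §4.2, the Schur remark p. 156] -/
theorem hasUnitaryLift_repTransport_archWeilRep [Algebra.IsQuadraticExtension F E] {δ : E} (hcδ : c δ = -δ)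
    (hδ : δ ≠ 0) {d : F} (hd : δ * δ = algebraMap F E d) {TV : Matrix (Fin N) (Fin N) F} {TW : Matrix (Fin M) (Fin M) F}
    (hV : TV.IsSymm) (hW : TW.IsSymm) (hVd : IsUnit TV.det) (hWd : IsUnit TW.det)
    (hJV : JV = TV.map (algebraMap F E)) (hJW : JW = TW.map (algebraMap F E))
    {n : ℕ} (e : Fin N × Fin M ≃ Fin n)
    (s : UnitaryGroup.adelicPair F E c N M JV JW →* adelicMpCont F (Fin n) (UnitaryDualPair.adelicGram F e TV TW))
    (hs : ∀ g, adelicMpCont.proj F (Fin n) (UnitaryDualPair.adelicGram F e TV TW) (s g) =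
      UnitaryDualPair.toSp F E c N M e JV JW hcδ hδ hd hV hW hJV hJW g)
    (hsc : Continuous fun u => UnitaryDualPair.pairSplitting F E c N M e JV JW s (archProdHom F E c N M JV JW u))
    {σ : Type} [Fintype σ] [DecidableEq σ] (e' : (Fin n → mixedEmbedding.mixedSpace F) ≃L[ℝ] (σ → ℝ))
    (hTa : IsUnit (archMat F (Fin n) (UnitaryDualPair.adelicGram F e TV TW)))
    {G' : Type*} [Monoid G'] [TopologicalSpace G'] {K : Type*} [TopologicalSpace K] {P : Type*} [TopologicalSpace P]
    {γ : G' → PhaseMap σ} {κ : K → G'} {a : P → G'} {WK : K → (SchwartzMap (σ → ℝ) ℂ →L[ℂ] SchwartzMap (σ → ℝ) ℂ)}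
    {WA : P → (SchwartzMap (σ → ℝ) ℂ →L[ℂ] SchwartzMap (σ → ℝ) ℂ)} (D : KAKImplementerData γ κ a WK WA)
    (ϖ : UnitaryGroup.arch F E c N JV × UnitaryGroup.arch F E c M JW → G') (hϖ : Continuous ϖ)
    (hγ : ∀ (u : UnitaryGroup.arch F E c N JV × UnitaryGroup.arch F E c M JW) (pq : (σ → ℝ) × (σ → ℝ)),
      archPhaseMap (UnitaryDualPair.adelicGram F e TV TW) e' hTa
        (UnitaryDualPair.toSp F E c N M e JV JW hcδ hδ hd hV hW hJV hJW
          (UnitaryGroup.adelicInl F E c N M JV JW (UnitaryGroup.archToAdelic F E c N JV u.1) *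
            UnitaryGroup.adelicInr F E c N M JV JW (UnitaryGroup.archToAdelic F E c M JW u.2))) pq = γ (ϖ u) pq)
    (hmul : ∀ (g h : UnitaryGroup.arch F E c N JV × UnitaryGroup.arch F E c M JW) (pq : (σ → ℝ) × (σ → ℝ)),
      γ (ϖ (g * h)) pq = γ (ϖ g) (γ (ϖ h) pq))
    (htriv : ∀ nn : UnitaryGroup.arch F E c N JV × UnitaryGroup.arch F E c M JW → ℝ,
      (∀ g h, nn (g * h) = nn g * nn h) → (∀ g, 0 < nn g) → Continuous nn → ∀ g, nn g = 1)
    (u : UnitaryGroup.arch F E c N JV × UnitaryGroup.arch F E c M JW) :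
    ∃ U : Lp ℂ 2 (volume : Measure (σ → ℝ)) ≃ₗᵢ[ℂ] Lp ℂ 2 (volume : Measure (σ → ℝ)),
      LiftsTo (repTransport e' (archWeilRep F E c N M JV JW hcδ hδ hd hV hW hVd hWd hJV hJW e s hs) u)
        ((U.toContinuousLinearEquiv : Lp ℂ 2 (volume : Measure (σ → ℝ)) ≃L[ℂ] Lp ℂ 2 (volume : Measure (σ → ℝ))) :
          Lp ℂ 2 (volume : Measure (σ → ℝ)) →L[ℂ] Lp ℂ 2 (volume : Measure (σ → ℝ))) :=
  hasUnitaryLift_of_coeff D _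
    (continuous_repTransport_archWeilRep F E c N M JV JW hcδ hδ hd hV hW hVd hWd hJV hJW e s hs e') ϖ hϖ
    (isPhaseCovariantS_repTransport_archWeilRep F E c N M JV JW hcδ hδ hd hV hW hVd hWd hJV hJW e s hs e' hTa γ ϖ hγ)
    (continuous_repTransport_archWeilRep_apply_apply F E c N M JV JW hcδ hδ hd hV hW hVd hWd hJV hJW e s hs hsc e') hmul
    htriv u

end Pair

end HodgeCM.Model.HypCensus

end
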